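import Mathlib.NumberTheory.Real.Irrational
import Mathlib.Analysis.SpecialFunctions.Pow.Real
import Mathlib.Data.Set.Card
import Literature.NumberTheory.Transcendental.PeriodsWave0
import HarnessLib

/-!
# Many odd zeta values are irrational (Fischler–Sprang–Zudilin 2019)

Topic `Literature/NumberTheory/Irrationality/FischlerSprangZudilin2019`. Typed, cited statement (no
proof) of the main theorem of S. Fischler, J. Sprang, W. Zudilin, *Many odd zeta values are
irrational*, Compositio Math. **155** (2019) 938–952 = arXiv:1803.08905 [FischlerSprangZudilin2019].
PRIMARY SOURCE read on the page (held: `paper:arxiv-1803.08905`, §1): the paper's first displayed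
theorem is Ball–Rivoal's ("Theorem 1 (Ball–Rivoal). Let `ε > 0`. Then for any `s ≥ 3` odd and
sufficiently large with respect to `ε`, we have
`dim_ℚ Span_ℚ(1, ζ(3), ζ(5), ζ(7), …, ζ(s)) ≥ (1-ε) log s / (1 + log 2)`" — the tree's PROVED
`Literature.NumberTheory.Transcendental.ball_rivoal`), and the main result is:
"**Theorem 2.** Let `ε > 0`, and `s ≥ 3` be an odd integer sufficiently large with respect to `ε`.
Then among the numbers `ζ(3), ζ(5), ζ(7), …, ζ(s)`, at least `2^{(1-ε) log s / log log s}` are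
irrational." ("In this result, the lower bound is asymptotically greater than `exp(√(log s))`, and
than any power of `log s`"; Theorem (thBR) "gives only `(1-ε) log s/(1+log 2)` irrational odd zeta
values, but they are linearly independent over the rationals, whereas Theorem (th1) ends up only
with their irrationality".) Method: Zudilin's and Sprang's elimination of many odd zeta values at
once from linear forms in Hurwitz zeta values, with `D` a large primorial (§§2–6).

Later records of the same COUNTING type (for the cell's FRESHNESS; not typed here): Lai–Yu,
Compositio Math. 156 (2020): `(1.19… - ε) √(s / log s)`; Fischler, J. London Math. Soc. 113 (2026)
Thm 1 (`Literature/…/Fischler2026/OddZetaLinearIndependence.lean`): `0.21 √(s / log s)` of them even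
LINEARLY INDEPENDENT with `1`.

Rendering: `ζ(k) = zetaValue k` (`PeriodsWave0.lean`); "sufficiently large with respect to `ε`" as
`∃ s₀, ∀ s ≥ s₀`; the count as the `Set.ncard` of the (finite) set of odd `i ∈ [3, s]` with `ζ(i)`
irrational; the real power `2^{(1-ε) log s / log log s}` with `Real.rpow`.

Cell pub-zeta5 (HONEST FRAMING: systematic search; no irrationality claim unless certified): a
RECORD entry for the independence/elimination lanes (`fam-indep`, `fam-elim`); nothing here bears on
`ζ(5)` itself ("the question whether `ζ(5)` is irrational remains open", ibid. §1).
-/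

noncomputable section

namespace Literature.NumberTheory.Irrationality.FischlerSprangZudilin2019

open Literature.NumberTheory.Transcendental (zetaValue)

/-- **Fischler–Sprang–Zudilin 2019, main theorem** (named fact, statement only): for every `ε > 0`
and every sufficiently large odd `s`, at least `2^{(1-ε) log s / log log s}` of the numbers
`ζ(3), ζ(5), …, ζ(s)` are irrational — rendered with the count as the cardinality of
`{i odd, 3 ≤ i ≤ s, ζ(i) ∉ ℚ}`.
[cite: FischlerSprangZudilin2019, §1 Theorem 2 (main theorem; Theorem 1 there is Ball–Rivoal), arXiv:1803.08905 p. 2] -/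
def manyOddZetaValuesIrrational : Prop :=
  ∀ ε : ℝ, 0 < ε → ∃ s₀ : ℕ, ∀ s : ℕ, s₀ ≤ s → Odd s →
    (2 : ℝ) ^ ((1 - ε) * Real.log s / Real.log (Real.log s)) ≤
      (({i : ℕ | Odd i ∧ 3 ≤ i ∧ i ≤ s ∧ Irrational (zetaValue i)}).ncard : ℝ)

end Literature.NumberTheory.Irrationality.FischlerSprangZudilin2019
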